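import Mathlib
import Summits.HodgeConjecture.FermatCycles.HodgeFermatDecodingC
import Summits.HodgeConjecture.FermatCycles.HodgeFermatHurwitzZeroB

/-!
# THEOREM F* at the prime levels `3p`, `p ≥ 11`, `p ≠ 13` — unconditional (`HodgeFermat/DecodingFinal.lean`; HF-G32, final form)

Tree copy of the module `HodgeFermat/DecodingFinal.lean` of the sibling cell's standalone package
`run/shared/lean/pub/pub-hodgefermat/lean/HodgeFermat/` (37 lines, sha256 `fd156a245db3c849…`), and the closing file of
the chain `HodgeFermatThmFstarStatement` → `HodgeFermatLemmaNA/B` → `HodgeFermatChiThreeA/B` → `HodgeFermatTwistedMomentA/B` →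
`HodgeFermatLemmaEMu` → (`HodgeFermatMuEven`; `HodgeFermatLemmaENu` → `HodgeFermatNuChar` → `HodgeFermatNuOdd` →
`HodgeFermatNuOddSharp`) → `HodgeFermatDecodingA/B/C`, and `HodgeFermatHurwitzZeroA/B`, filed by cell `pub-hfermat`, seat
prover-1 gen-0, on the COORDINATOR KEEPER RULING of 2026-08-25 (gem sweep H1: take the off-gate kernel theorem `thmFstar`
through the gate).  The source module's declarations are VERBATIM those of the cell record
`check/DecodingFinal_standalone.lean` (27 bodies, 454 223 B, sha256 dca6f17de93119a6…, hub `lean check` rc 0, 130.1 s;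
pub-hodgefermat `CERT.md` l.978, GATE HF-G32).

Deviations from the source module, exhaustively: the `import` lines; this module docstring; the proof term of `h0` —
the source has `theorem h0 : H0 := HodgeFermat.KRFree.HurwitzZero.hypH0`, where `hypH0 : HypBReduction.HypH0` lives in
§6 of `HurwitzZero.lean` behind the 17-module analytic THEOREM-D6 chain (`HypBReduction`) and `HypH0` is VERBATIM the
same `Prop` as `LemmaEMu.H0`; here `h0` is proved by the one-line term of `hypH0` itself
(`fun _ hx0 hx1 => hurwitzZeta_zero hx0 hx1`, source `HurwitzZero.lean` l.508) from `HodgeFermatHurwitzZeroB.lean`, so that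
the D6 chain is not imported; and the NEW closing theorem `thmFstar_holds : ThmFstar` (the statement filed first,
count-neutral, in `HodgeFermatThmFstarStatement.lean`), a re-packaging of `thmFstar` with no mathematical content.
The statement and proof of `thmFstar` are byte-identical to the source (`DecodingFinal.lean` l.26–35).

Trust base: no hypotheses, no `sorry`; axioms of `thmFstar` / `thmFstar_holds` = [propext, Classical.choice, Quot.sound]
(Mathlib's Dirichlet `L(χ, 1) ≠ 0`, the Hurwitz zeta functional equation, and the files above).
HONEST FRAMING: explicit algebraic cycles for specific Hodge classes on Fermat/Delsarte varieties; residual open instances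
listed; no claim on general Hodge.  (THEOREM F* is arithmetic of CM types of Fermat-curve triples at level `3p`; it is the
decoding step of the sibling's analysis of the Hodge gap group `G_{3p}` — DOOR.md §0 of this cell — and claims nothing
about cycles.)

The source module's docstring (DecodingFinal.lean l.4–18), verbatim:

## THEOREM F* at the prime levels 3p, p ≥ 11, p ≠ 13 — unconditional (HF-G32, final form)

`HodgeFermat/Decoding.lean` proves THEOREM F* of `tables/DPRIME-THEOREM.md` §9 at every prime level `3p`, `p ≥ 11`, `p ≠ 13`,
from the Hurwitz special value `H0` (`ζ(0, x) = 1/2 − x`): two DISJOINT zero-sum triples mod `3p` with entries prime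
to `p` never have the same CM type (point evaluation of "μ_T − μ_T′ even" and "ν_T − ν_T′ odd", HF-G31c/e, the latter
sharpened to `p ≥ 11`, `p ≠ 13` in `NuOddSharp`).
`HodgeFermat/HurwitzZero.lean` (generation 23) proves `H0` (`hypH0 : HypBReduction.HypH0`, the same term as
`LemmaEMu.H0`).  This module puts them together: the hypothesis-free `thmFstar` — no `KR6′`, no `ThmUPlus′`, no
postulate (entries divisible by `p`: `DecodingDPrime`).  Heavy import (the analytic chain of 17 modules); hub record
`check/DecodingFinal_standalone.lean` (27 bodies; the module-docstring blocks are stripped by `code/gen32/mkstandalone_g32.py --strip-moddoc` to stay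
under the hub's one-file cap).
NOT imported by the root `HodgeFermat.lean`.
-/

namespace HodgeFermat.KRFree.DecodingFinal

open HodgeFermat.KRFree.LemmaN HodgeFermat.KRFree.LemmaEMu

/-- `ζ(0, x) = 1/2 − x` (`0 < x < 1`): the hypothesis `H0` of the light modules is the theorem
`HurwitzZero.hurwitzZeta_zero` (source: `:= HodgeFermat.KRFree.HurwitzZero.hypH0`, the same term behind one more name). -/
theorem h0 : H0 := fun _ hx0 hx1 => HodgeFermat.KRFree.HurwitzZero.hurwitzZeta_zero hx0 hx1

/-- **THEOREM F\* at the prime levels — unconditional.**  Let `p ≥ 11`, `p ≠ 13` be prime and let `(a, b, c)`, `(a′, b′, c′)` be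
zero-sum triples mod `3p` with all entries prime to `p`, DISJOINT mod `3p` (no entry of the first is congruent to an
entry of the second).  Then they do not have the same CM type (`LemmaN.SameType`: `H_T ∩ (ℤ/3p)ˣ ≠ H_{T′} ∩ (ℤ/3p)ˣ`). -/
theorem thmFstar {p : ℕ} (hp : p.Prime) (hp11 : 11 ≤ p) (hp13 : p ≠ 13) {a b c a' b' c' : ℕ}
    (hs : 3 * p ∣ a + b + c) (hs' : 3 * p ∣ a' + b' + c')
    (ha : Nat.Coprime a p) (hb : Nat.Coprime b p) (hc : Nat.Coprime c p)
    (ha' : Nat.Coprime a' p) (hb' : Nat.Coprime b' p) (hc' : Nat.Coprime c' p)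
    (hD : ∀ u v, (u = a ∨ u = b ∨ u = c) → (v = a' ∨ v = b' ∨ v = c') → ¬ u ≡ v [MOD 3 * p])
    (hT : SameType (3 * p) (a, b, c) (a', b', c')) : False :=
  Decoding.thmFstar h0 hp hp11 hp13 hs hs' ha hb hc ha' hb' hc' hD hT

/-- **THEOREM F\* at the prime levels, as filed** (`HodgeFermatThmFstarStatement.lean`): `ThmFstar` holds — for every prime
`p ≥ 11`, `p ≠ 13`, two zero-sum triples mod `3p` with all entries prime to `p` and DISJOINT mod `3p` do not have the same
CM type.  Unconditional; this is `thmFstar` with its binders packaged as the `Prop` `ThmFstar`. -/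
theorem thmFstar_holds : ThmFstar :=
  fun _ hp hp11 hp13 _ _ _ _ _ _ hs hs' ha hb hc ha' hb' hc' hD hT =>
    thmFstar hp hp11 hp13 hs hs' ha hb hc ha' hb' hc' hD hT

end HodgeFermat.KRFree.DecodingFinal
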